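import Summits.QuantumFields.BalabanUV.T4Continuum.Spine.NE4.FadingFromRateRelAnalytic

/-!
# Spine/NE4/FadingFromRateRelAnalyticSharp — under RELATIVE charts the LOG currency is NECESSARY: a family with `ScaleShiftRate` and
# `LocalAnalyticRel` whose g-currency history moduli (`HistLipschitz`) do NOT EXIST at all, while (R40) gives its log-currency moduli

Cell `pub-balaban-gaps` (YM blitz G2), seat `ne4`, generation 7 (unit `pub-balaban-gaps-ne4-g7`); record `HOME/ne/NE4.md` §5 (R40), sharpness companion
of `Spine/NE4/FadingFromRateRelAnalytic` (whose headline `histLipschitzLog_fadingMemory_of_localAnalyticRel` derives, from the REAL NE4 + relative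
real-analytic charts `LocalAnalyticRel B γ ρ β`, history moduli in the LOG currency `T4CurrencyMatching.HistLipschitzBy Real.log`).

THE POINT.  Census question: is the change of currency in (R40) (from the tree's g-currency `T4CouplingMatching.HistLipschitz` — moduli against
`|Δg_i|`, used by every earlier `Spine/NE4` face — to the log currency) a convenience or a necessity?  A NECESSITY: the Markovian toy
`logOscFamily ω`, `β_{k+1}(g_0,…,g_k) = sin(ω·log g_k)`, has `ScaleShiftRate 0 θ γ` (its scale shift vanishes), `LocalAnalyticRel (e^{ωπ∕2}) γ ρ` for
every `ρ < 1` (chart `z ↦ sin(ω·log z)` on the relative discs, which lie in `Re z > 0`, where `|Im(ω log z)| = ω|arg z| ≤ ωπ∕2`), hence (R40)'s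
log-currency moduli — but NO g-currency moduli whatsoever: `¬ HistLipschitz Λ γ (logOscFamily ω)` for EVERY `Λ` (`not_histLipschitz_logOscFamily`: at
scale `0` the couplings `e^{(π∕2 − 2πn)∕ω}`, `e^{(−π∕2 − 2πn)∕ω}` are arbitrarily close to `0` and to each other while `β₁` takes the values `1` and
`−1`).  So under the printed-domain analyticity shape the g-currency `U2Inputs` triple of `Spine/NE4/Targets` can FAIL while node U2 still closes
through `T4CurrencyMatching` (R40) — the log currency (relative coupling discrepancies, node U3's analytic member's currency) is the right one.

HONEST FRAMING: a toy family over hypothesis shapes; nothing of Bałaban's asserted; NE4 NOT IN PRINT, NOT PROVED; 0∕6, 0∕9; NOT continuum on ℝ⁴, NOT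
infinite volume, NOT a mass gap, NOT Clay.  0 sorry; axioms standard; imports `Spine/NE4/FadingFromRateRelAnalytic` only (the sine bound
`Literature.NumberTheory.LFunctions.norm_sin_le_exp_abs_im` BY NAME, transitively).
Reference (TYPES only): [Balaban1987RG1] = T. Bałaban, CMP **109** (1987) 249–301, §1 p. 264.
-/

noncomputable section

namespace Summit.QuantumFields.BalabanUV.T4Continuum.Spine.NE4

open Set Metric Filter Topology
open Literature.MathematicalPhysics.QuantumFieldTheory.Balaban1983to89
open Literature.MathematicalPhysics.QuantumFieldTheory.Balaban1983to89.FlowStep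
open Literature.MathematicalPhysics.QuantumFieldTheory.Balaban1983to89.T4CouplingMatching

/-- The log-oscillating Markovian toy `β_{k+1}(g_0,…,g_k) = sin(ω·log g_k)`. [folklore] -/
def logOscFamily (ω : ℝ) : HBeta := fun k v => Real.sin (ω * Real.log (v (Fin.last k)))

/-- `|logOscFamily ω| ≤ 1`. [folklore] -/
theorem abs_logOscFamily_le_one (ω : ℝ) (k : ℕ) (v : Fin (k + 1) → ℝ) : |logOscFamily ω k v| ≤ 1 :=
  Real.abs_sin_le_one _

/-- The toy is Markovian: its scale shift vanishes, `ScaleShiftRate 0 θ γ`. [folklore] -/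
theorem scaleShiftRate_logOscFamily (ω θ γ : ℝ) : ScaleShiftRate 0 θ γ (logOscFamily ω) := by
  intro k w _
  have h : Fin.tail w (Fin.last k) = w (Fin.last (k + 1)) := by rw [Fin.tail, Fin.succ_last]
  simp [logOscFamily, h]

/-- **THE TOY HAS RELATIVE CHARTS** (`ω ≥ 0`, `ρ < 1`, bound `e^{ωπ∕2}`): in the last coupling the chart about `x > 0` is `z ↦ sin(ω·log z)` on the
disc of radius `ρx`, contained in `Re z > 0` ⊆ the slit plane (`log` holomorphic), where `|Im(ω·log z)| = ω·|arg z| ≤ ωπ∕2` bounds `‖sin‖` by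
`e^{ωπ∕2}`; in the other couplings the section is constant. [folklore] -/
theorem localAnalyticRel_logOscFamily {ω γ ρ : ℝ} (hω : 0 ≤ ω) (hρ1 : ρ < 1) :
    LocalAnalyticRel (Real.exp (ω * (Real.pi / 2))) γ ρ (logOscFamily ω) := by
  intro k p hp i x hx
  have hx0 : 0 < x := hx.1
  have h1B : (1 : ℝ) ≤ Real.exp (ω * (Real.pi / 2)) := Real.one_le_exp (by positivity)
  by_cases hi : i = Fin.last k
  · subst hi
    have hre : ∀ z ∈ ball (x : ℂ) (ρ * x), 0 < z.re := fun z hz => by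
      have h1 : ‖z - (x : ℂ)‖ < ρ * x := mem_ball_iff_norm.mp hz
      have h2 : |(z - (x : ℂ)).re| ≤ ‖z - (x : ℂ)‖ := Complex.abs_re_le_norm _
      have h3 : (z - (x : ℂ)).re = z.re - x := by simp
      rw [h3] at h2
      have h4 : x - z.re < ρ * x := lt_of_le_of_lt ((neg_sub z.re x ▸ neg_le_abs (z.re - x))) (h2.trans_lt h1)
      nlinarith
    refine ⟨fun z => Complex.sin ((ω : ℂ) * Complex.log z), fun z hz => ?_, fun z hz => ?_, fun t ht _ => ?_⟩
    · have hsl : z ∈ Complex.slitPlane := Or.inl (hre z hz)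
      exact ((differentiableAt_id.clog hsl).const_mul (ω : ℂ)).csin.differentiableWithinAt
    · refine (Literature.NumberTheory.LFunctions.norm_sin_le_exp_abs_im _).trans (Real.exp_le_exp.mpr ?_)
      have him : ((ω : ℂ) * Complex.log z).im = ω * Complex.arg z := by
        rw [Complex.im_ofReal_mul, Complex.log_im]
      rw [him, abs_mul, abs_of_nonneg hω]
      exact mul_le_mul_of_nonneg_left (Complex.abs_arg_le_pi_div_two_iff.mpr (hre z hz).le) hω
    · simp only [logOscFamily, Function.update_self]
      rw [← Complex.ofReal_log ht.1.le]
      push_cast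
      ring_nf
  · refine ⟨fun _ => (logOscFamily ω k p : ℂ), differentiableOn_const _, fun z _ => ?_, fun t _ _ => ?_⟩
    · rw [Complex.norm_real, Real.norm_eq_abs]
      exact (abs_logOscFamily_le_one ω k p).trans h1B
    · simp only [logOscFamily, Function.update_of_ne (Ne.symm hi)]

/-- **NO g-CURRENCY HISTORY MODULI AT ALL** (`ω > 0`, `γ > 0`): `¬ HistLipschitz Λ γ (logOscFamily ω)` for EVERY `Λ` — at scale `0` the couplings
`p = e^{(π∕2 − 2πn)∕ω}`, `q = e^{(−π∕2 − 2πn)∕ω}` lie in `]0,γ]` for `n` large with `|p − q| ≤ p → 0`, while `β₁(p) − β₁(q) = 1 − (−1) = 2`.  So under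
`LocalAnalyticRel` the tree's g-currency shape `HistLipschitz` (every earlier `Spine/NE4` face, `Targets.U2Inputs`) can FAIL outright, whereas (R40)'s
log-currency moduli exist: the change of currency is NECESSARY. [folklore] -/
theorem not_histLipschitz_logOscFamily {ω γ : ℝ} (hω : 0 < ω) (hγ : 0 < γ) (Λ : ℕ → ℕ → ℝ) :
    ¬ HistLipschitz Λ γ (logOscFamily ω) := by
  intro hL
  set L : ℝ := Λ 0 0 with hLdef
  -- a small target below `γ` and below `1/(|L|+1)`
  set ε : ℝ := min γ (1 / (|L| + 1)) with hε
  have hε0 : 0 < ε := lt_min hγ (by positivity)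
  -- choose `n` with `(π/2 − 2πn)/ω ≤ log ε`
  obtain ⟨n, hn⟩ := exists_nat_gt ((Real.pi / 2 - ω * Real.log ε) / (2 * Real.pi))
  set a : ℝ := (Real.pi / 2 - (n : ℝ) * (2 * Real.pi)) / ω with ha
  set b : ℝ := (-(Real.pi / 2) - (n : ℝ) * (2 * Real.pi)) / ω with hb
  have hab : b < a := by rw [ha, hb]; exact div_lt_div_of_pos_right (by linarith [Real.pi_pos]) hω
  have ha_le : a ≤ Real.log ε := by
    rw [ha, div_le_iff₀ hω]
    have h2π : 0 < 2 * Real.pi := by linarith [Real.pi_pos]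
    have := (div_lt_iff₀ h2π).mp hn
    linarith
  set p : ℝ := Real.exp a with hp
  set q : ℝ := Real.exp b with hq
  have hp0 : 0 < p := Real.exp_pos a
  have hq0 : 0 < q := Real.exp_pos b
  have hpε : p ≤ ε := by rw [hp]; exact (Real.exp_le_exp.mpr ha_le).trans_eq (Real.exp_log hε0)
  have hqp : q < p := Real.exp_lt_exp.mpr hab
  have hpγ : p ≤ γ := hpε.trans (min_le_left _ _)
  -- the two scale-0 histories
  let P : Fin 1 → ℝ := fun _ => p
  let Q : Fin 1 → ℝ := fun _ => q
  have hP : P ∈ Box γ 0 := mem_box.mpr fun _ => ⟨hp0, hpγ⟩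
  have hQ : Q ∈ Box γ 0 := mem_box.mpr fun _ => ⟨hq0, hqp.le.trans hpγ⟩
  have hval : logOscFamily ω 0 P - logOscFamily ω 0 Q = 2 := by
    have e1 : ω * Real.log p = Real.pi / 2 - (n : ℝ) * (2 * Real.pi) := by rw [hp, Real.log_exp, ha]; field_simp
    have e2 : ω * Real.log q = -(Real.pi / 2) - (n : ℝ) * (2 * Real.pi) := by rw [hq, Real.log_exp, hb]; field_simp
    simp only [logOscFamily, P, Q]
    rw [e1, e2, Real.sin_sub_nat_mul_two_pi, Real.sin_sub_nat_mul_two_pi, Real.sin_neg, Real.sin_pi_div_two]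
    norm_num
  have h := hL 0 P Q hP hQ
  rw [hval, Fin.sum_univ_one] at h
  have h' : (2 : ℝ) ≤ Λ 0 0 * |P 0 - Q 0| := by
    have e : ((0 : Fin 1) : ℕ) = 0 := rfl
    rw [e, abs_of_pos (by norm_num : (0 : ℝ) < 2)] at h
    exact h
  -- `2 ≤ L·|p − q| ≤ |L|·p ≤ |L|·ε < 1`
  have hpq : |P 0 - Q 0| ≤ p := by
    show |p - q| ≤ p
    rw [abs_of_pos (by linarith)]; linarith
  have h1 : Λ 0 0 * |P 0 - Q 0| ≤ |L| * p :=
    (le_abs_self _).trans (by rw [abs_mul, abs_abs]; exact mul_le_mul_of_nonneg_left hpq (abs_nonneg _))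
  have h2 : |L| * p ≤ |L| * (1 / (|L| + 1)) := mul_le_mul_of_nonneg_left (hpε.trans (min_le_right _ _)) (abs_nonneg _)
  have h3 : |L| * (1 / (|L| + 1)) < 1 := by
    rw [mul_one_div, div_lt_one (by positivity)]; linarith
  linarith [h', h1, h2, h3]

/-- **PACKAGE — THE LOG CURRENCY IS NECESSARY UNDER RELATIVE CHARTS** (`ω > 0`, `γ > 0`, `0 < ρ < 1`, any `0 < θ < 1`): the toy meets BOTH hypotheses of
(R40)'s headline (`ScaleShiftRate 0 θ γ`, `LocalAnalyticRel (e^{ωπ∕2}) γ ρ`) — so its LOG-currency moduli with fading memory exist by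
`histLipschitzLog_fadingMemory_of_localAnalyticRel` — and admits NO g-currency moduli. [folklore] -/
theorem logCurrency_necessary {ω γ ρ θ : ℝ} (hω : 0 < ω) (hγ : 0 < γ) (hρ0 : 0 < ρ) (hρ1 : ρ < 1) (hθ0 : 0 < θ) (hθ1 : θ < 1) :
    ScaleShiftRate 0 θ γ (logOscFamily ω) ∧ LocalAnalyticRel (Real.exp (ω * (Real.pi / 2))) γ ρ (logOscFamily ω) ∧
      T4CurrencyMatching.HistLipschitzBy Real.log (relAnalyticModuli 0 θ (Real.exp (ω * (Real.pi / 2))) (min ρ 1)) γ (logOscFamily ω) ∧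
      ∀ Λ, ¬ HistLipschitz Λ γ (logOscFamily ω) := by
  have hL := localAnalyticRel_logOscFamily (γ := γ) hω.le hρ1
  refine ⟨scaleShiftRate_logOscFamily ω θ γ, hL, ?_, not_histLipschitz_logOscFamily hω hγ⟩
  exact (histLipschitzLog_fadingMemory_of_localAnalyticRel (localAnalyticRel_mono hL (min_le_left _ _))
    (scaleShiftRate_logOscFamily ω θ γ) le_rfl hθ0 hθ1 (Real.exp_pos _) (lt_min hρ0 one_pos) (min_le_right _ _) hγ).1

end Summit.QuantumFields.BalabanUV.T4Continuum.Spine.NE4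

end
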